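import Literature.AlgebraicGeometry.Motives.AbelianVarietyAutBaseChangeTransfer
import Literature.AlgebraicGeometry.AbelianVarieties.HomogeneousLineBundleFieldChange
import Literature.AlgebraicGeometry.AbelianVarieties.HomogeneousDivisorClassTransfer
import Literature.AlgebraicGeometry.Motives.AbelianVarietyWeilPairingRadical
import Literature.AlgebraicGeometry.Motives.AbelianVarietyPrincipalPolarizationMultiplicity
import HarnessLib

/-!
# `#K(Θ)` is invariant under linear equivalence, isomorphisms, and change of algebraically closed field
# ([MumfordAV1970] §6 Definition p. 60, §6 Application 3, §8; [SerreTate1968] §1)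

Layer `Literature/AlgebraicGeometry/Motives`, namespace `Literature.AlgebraicGeometry.Motives.AbelianVariety`.  THEOREMS ONLY (no
definition, no named fact, no instance, no notation, no `sorry`).  Cell `hodgecm-mathlib` (D-0151), F-DAG F-2 (b) RANK brick, leaf
(R3) «transport `ℂ ⇝ Ω`» (B-plan1 (g16) 07:48:31Z; census `B-provers/B-p05/g17/CENSUS-F2b-Rank.B-p05g17.md` §3 (R3); B-p11 (g17)):
the `#K(Θ)`-half of the transport of «`h⁰(A, 𝒪(Θ))² = #K(Θ)`» from `ℂ` to every algebraically closed field of characteristic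
`0` (the `h⁰`-half is flat base change of `H⁰`, ★ `Modules/CohomologyFlatBaseChange`; the assembly is the sequel
`Motives/AbelianVarietyH0SqEqCardKThetaAnyField`).  HC_CM is proved only modulo the 7 printed citations until rung 0 closes; nothing here
bears on a summit statement.

For an abelian variety `B` over a field and a Cartier divisor `Θ`, `K(Θ) = {P ∈ B(K) ; t_P^*Θ ∼ Θ}` (★ `AbelianVariety.KTheta`,
a subgroup of the rational points).

* §1 (`K(D) = K(D′)` for `D ∼ D′` is ★ `KTheta_congr_linEquiv`); **`natCard_KTheta_pullback_iso`** — `#K(e^*D) = #K(D)` for an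
  isomorphism `e : B′ ≅ B` (`t_P ≫ e = e ≫ t_{e(P)}`, ★ `translation_left_comp_toSchemeHom`).
* §2 **`natCard_KTheta_baseChange_eq`** — for `k ⊆ L` BOTH algebraically closed of characteristic `0`, `Θ` AMPLE on `B / k` and the
  projection `π : B_L → B`: `#K(π^*Θ)(L) = #K(Θ)(k)`.  The injective homomorphism `Q ↦ Q_L : B(k) → B_L(L)` (★
  `exists_monoidHom_points_baseChange`, B-p13 (g19)) maps `K(Θ)` into `K(π^*Θ)` (`t_{Q_L} ≫ π = π ≫ t_Q`, ★
  `translation_left_comp_baseChangeFst`) and ONTO it: `K(π^*Θ)` is FINITE (★ `finite_KTheta`, ampleness), so its points are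
  torsion and therefore of the form `Q_L` (★ `exists_pointsMulEquiv_extendScalars_eq_of_pow_eq_one`: `B_L[N](L) = B[N](k)` for
  algebraically closed `k ⊆ L`, [MumfordAV1970] §6 App. 3), while `t_Q^*Θ ∼ Θ` descends from `L` to `k` (★
  `linEquiv_zero_of_classPullback_baseChangeAlongFst`: `Pic(B) ↪ Pic(B_L)`, [GortzWedhorn2023] Thm. 24.66 (1)).

## References
* [MumfordAV1970] D. Mumford, *Abelian Varieties*, TIFR Studies in Mathematics 5 (1970), §6 Definition (p. 60) and Application 3
  (Proposition p. 64), §8 (`K(L)`, `φ_L`).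
* [SerreTate1968] J.-P. Serre, J. Tate, Good reduction of abelian varieties, Ann. of Math. 88 (1968), §1 p. 493.
* [GortzWedhorn2023] U. Görtz, T. Wedhorn, *Algebraic Geometry II: Cohomology of Schemes* (2023), Thm. 24.66 (1) (p. 405).
-/

noncomputable section

open CategoryTheory CategoryTheory.Limits AlgebraicGeometry Function

universe u

namespace Literature.AlgebraicGeometry.Motives

namespace AbelianVariety

open Literature.AlgebraicGeometry.AbelianVarieties Literature.AlgebraicGeometry.AbelianVarieties.AbelianVariety
open scoped MonObj

/-! ## §1 `K(Θ)` depends only on the class of `Θ`; transport along an isomorphism -/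

section Field

variable {K : Type u} [Field K]

/-- **`#K(e^*D) = #K(D)` for an isomorphism `e : B′ ≅ B` of abelian varieties**: `P ↦ e(P)` is a bijection `B′(K) ≃ B(K)`
carrying `K(e^*D)` onto `K(D)` (`t_P ≫ e = e ≫ t_{e(P)}`, ★ `translation_left_comp_toSchemeHom`). [cite: MumfordAV1970, §6 Definition (p. 60) and §8] -/
theorem natCard_KTheta_pullback_iso {B' B : AbelianVariety K} (e : B' ≅ B) (D : CartierDivisor B.X.left) :
    haveI := isDominant_toSchemeHom_iso_hom e
    Nat.card (B'.KTheta (D.pullback (Hom.toSchemeHom e.hom))) = Nat.card (B.KTheta D) := by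
  haveI := isDominant_toSchemeHom_iso_hom e
  set g := Hom.toSchemeHom e.hom with hg
  -- membership: `P ∈ K(e^*D) ↔ e(P) ∈ K(D)`
  have hmem : ∀ P : B'.Points K, P ∈ B'.KTheta (D.pullback g) ↔ AlgPoints.map e.hom.hom.hom.hom P ∈ B.KTheta D := by
    intro P
    set Q : B.Points K := AlgPoints.map e.hom.hom.hom.hom P with hQ
    have hcomm : (B'.translation P).left ≫ g = g ≫ (B.translation Q).left := translation_left_comp_toSchemeHom e.hom P
    haveI : IsDominant ((B'.translation P).left ≫ g) := inferInstance
    haveI : IsDominant (g ≫ (B.translation Q).left) := inferInstance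
    have h123 : ((D.pullback g).pullback (B'.translation P).left).SameDivisor ((D.pullback (B.translation Q).left).pullback g) :=
      ((CartierDivisor.pullback_pullback_sameDivisor D g (B'.translation P).left).trans
        (CartierDivisor.pullback_congr_sameDivisor D hcomm)).trans
        (CartierDivisor.pullback_pullback_sameDivisor D (B.translation Q).left g).symm
    rw [mem_KTheta_iff', mem_KTheta_iff']
    constructor
    · intro hP
      -- `(t_Q^*D − D)` dies after `g^*`; `g` is an isomorphism, so pull back along `g⁻¹`
      have h1 : ((D.pullback (B.translation Q).left).pullback g).LinEquiv (D.pullback g) := h123.linEquiv.symm.trans hP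
      let g' := Hom.toSchemeHom e.inv
      haveI : IsDominant g' := isDominant_toSchemeHom_iso_hom e.symm
      have hgg : g' ≫ g = 𝟙 _ := by
        change Hom.toSchemeHom (e.inv ≫ e.hom) = _; rw [e.inv_hom_id]; rfl
      haveI : IsDominant (g' ≫ g) := inferInstance
      have h2 := h1.pullback g'
      have hL : (((D.pullback (B.translation Q).left).pullback g).pullback g').SameDivisor (D.pullback (B.translation Q).left) :=
        ((CartierDivisor.pullback_pullback_sameDivisor _ g g').trans (CartierDivisor.pullback_congr_sameDivisor _ hgg)).trans
          (CartierDivisor.pullback_id_sameDivisor _)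
      have hR : ((D.pullback g).pullback g').SameDivisor D :=
        ((CartierDivisor.pullback_pullback_sameDivisor _ g g').trans (CartierDivisor.pullback_congr_sameDivisor _ hgg)).trans
          (CartierDivisor.pullback_id_sameDivisor _)
      exact (hL.linEquiv.symm.trans h2).trans hR.linEquiv
    · intro hQ'
      exact h123.linEquiv.trans (hQ'.pullback g)
  -- the bijection on points
  have hbij : Bijective (AlgPoints.map (L := K) e.hom.hom.hom.hom : B'.Points K → B.Points K) := by
    refine Function.bijective_iff_has_inverse.mpr ⟨AlgPoints.map e.inv.hom.hom.hom, fun P => ?_, fun Q => ?_⟩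
    · rw [← AlgPoints.map_comp_apply]
      change AlgPoints.map (e.hom ≫ e.inv).hom.hom.hom P = P
      rw [e.hom_inv_id]; exact AlgPoints.map_id_apply P
    · rw [← AlgPoints.map_comp_apply]
      change AlgPoints.map (e.inv ≫ e.hom).hom.hom.hom Q = Q
      rw [e.inv_hom_id]; exact AlgPoints.map_id_apply Q
  refine Nat.card_congr (Equiv.subtypeEquiv (Equiv.ofBijective _ hbij) fun P => ?_)
  exact hmem P

end Field

/-! ## §2 `K(Θ)` under change of algebraically closed field -/

section FieldChange

variable {k : Type u} [Field k] [IsAlgClosed k] [CharZero k] (L : Type u) [Field L] [Algebra k L] [IsAlgClosed L]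
  (B : AbelianVariety k) (Θ : CartierDivisor B.X.left)
  (π : (B.baseChange L).X.left ⟶ B.X.left) (hπ : π = pullback.fst B.X.hom (bcSpec k L))

include hπ in
/-- **`#K(Θ ⊗ L)(L) = #K(Θ)(k)` for `k ⊆ L` algebraically closed of characteristic `0` and `Θ` ample**: the injective
homomorphism `Q ↦ Q_L : B(k) → B_L(L)` (★ `exists_monoidHom_points_baseChange`) carries `K(Θ)` INTO `K(π^*Θ)` (`t_{Q_L} ≫ π =
π ≫ t_Q`, ★ `translation_left_comp_baseChangeFst`) and ONTO it: `K(π^*Θ)` is finite (★ `finite_KTheta`, `π^*Θ` ample), so its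
points are torsion, hence of the form `Q_L` (★ `exists_pointsMulEquiv_extendScalars_eq_of_pow_eq_one`, `k` algebraically closed), and
`t_Q^*Θ ∼ Θ` descends from `L` (★ `linEquiv_zero_of_classPullback_baseChangeAlongFst`: `Pic(B) ↪ Pic(B_L)`).
[cite: MumfordAV1970, §6 Application 3 (p. 64) and §8] [cite: SerreTate1968, §1 p. 493] -/
theorem natCard_KTheta_baseChange_eq [IsDominant π] (hΘ : Θ.IsAmple) :
    Nat.card ((B.baseChange L).KTheta (Θ.pullback π)) = Nat.card (B.KTheta Θ) := by
  obtain ⟨φ, hφinj, hφ, -⟩ := exists_monoidHom_points_baseChange L B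
  -- `φ Q` lies over `Q`
  have hover : ∀ Q : B.Points k, (φ Q).left ≫ π = bcSpec k L ≫ Q.left := by
    intro Q
    rw [hφ, hπ, pointsMulEquiv_apply, pointsEquiv_apply_left_comp_fst, AlgPoints.extendScalars_apply, Over.comp_left,
      AlgPoints.specOverMap_left]
    rfl
  -- the Weil divisors correspond: `D_{φ Q}(π^*Θ) ~ π^*(D_Q Θ)`
  have hsame : ∀ Q : B.Points k, ((B.baseChange L).weilDiv (Θ.pullback π) (φ Q)).SameDivisor ((B.weilDiv Θ Q).pullback π) := by
    intro Q
    have hc : ((B.baseChange L).translation (φ Q)).left ≫ π = π ≫ (B.translation Q).left :=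
      translation_left_comp_baseChangeFst L B π hπ (φ Q) Q (hover Q)
    haveI : IsDominant (((B.baseChange L).translation (φ Q)).left ≫ π) := inferInstance
    haveI : IsDominant (π ≫ (B.translation Q).left) := inferInstance
    unfold weilDiv
    refine CartierDivisor.SameDivisor.trans ?_ (CartierDivisor.pullback_add_sameDivisor _ _ π).symm
    refine CartierDivisor.SameDivisor.add ?_ (CartierDivisor.pullback_neg_sameDivisor _ _).symm
    exact ((CartierDivisor.pullback_pullback_sameDivisor Θ π _).trans (CartierDivisor.pullback_congr_sameDivisor Θ hc)).trans
      (CartierDivisor.pullback_pullback_sameDivisor Θ _ π).symm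
  -- membership is preserved and reflected
  have hmem : ∀ Q : B.Points k, Q ∈ B.KTheta Θ ↔ φ Q ∈ (B.baseChange L).KTheta (Θ.pullback π) := by
    intro Q
    rw [mem_KTheta_iff, mem_KTheta_iff]
    constructor
    · intro hQ
      refine (hsame Q).linEquiv.trans ?_
      exact (hQ.pullback π).trans (CartierDivisor.zero_pullback_sameDivisor π).linEquiv
    · intro hP
      have h1 : ((B.weilDiv Θ Q).pullback π).LinEquiv 0 := (hsame Q).linEquiv.symm.trans hP
      have h2 : ((B.weilDiv Θ Q).classPullback π).LinEquiv 0 :=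
        (CartierDivisor.classPullback_linEquiv_pullback π _).trans h1
      exact linEquiv_zero_of_classPullback_baseChangeAlongFst (algebraMap k L) B π hπ _ h2
  -- the restricted map is a bijection `K(Θ) ≃ K(π^*Θ)`
  let f : B.KTheta Θ → (B.baseChange L).KTheta (Θ.pullback π) := fun Q => ⟨φ Q.1, (hmem Q.1).1 Q.2⟩
  have hf_inj : Injective f := fun Q Q' h => Subtype.ext (hφinj (congrArg Subtype.val h))
  have hf_surj : Surjective f := by
    rintro ⟨P, hP⟩
    haveI : IsAffineHom (bcSpec k L) := isAffineHom_of_isAffine _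
    haveI : IsAffineHom π := by rw [hπ]; exact MorphismProperty.pullback_fst _ _ inferInstance
    -- `P` is torsion: `K(π^*Θ)` is finite
    haveI hfin : Finite ((B.baseChange L).KTheta (Θ.pullback π)) := (B.baseChange L).finite_KTheta (hΘ.pullback π)
    set N := Nat.card ((B.baseChange L).KTheta (Θ.pullback π)) with hN
    have hN0 : N ≠ 0 := Nat.card_pos.ne'
    have hPN : P ^ N = 1 := by
      have := (pow_card_eq_one' : (⟨P, hP⟩ : (B.baseChange L).KTheta (Θ.pullback π)) ^ N = 1)
      exact congrArg Subtype.val this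
    have hNk : (N : k) ≠ 0 := Nat.cast_ne_zero.mpr hN0
    obtain ⟨Q, -, hQ⟩ := exists_pointsMulEquiv_extendScalars_eq_of_pow_eq_one L B hNk hPN
    have hQ' : φ Q = P := (hφ Q).trans hQ
    refine ⟨⟨Q, (hmem Q).2 (hQ' ▸ hP)⟩, Subtype.ext hQ'⟩
  exact (Nat.card_eq_of_bijective f ⟨hf_inj, hf_surj⟩).symm

end FieldChange

end AbelianVariety

end Literature.AlgebraicGeometry.Motives
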